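import Summits.BirchSwinnertonDyer.BirchSwinnertonDyer.Theses.VerticalContact
import Summits.BirchSwinnertonDyer.BirchSwinnertonDyer.Theses.ToricShedding
import Summits.BirchSwinnertonDyer.BirchSwinnertonDyer.Theses.SelmerRank
import Summits.BirchSwinnertonDyer.BirchSwinnertonDyer.Theorems.TangentConeSelmerRankSmallImageReduction
import HarnessLib

/-!
# BirchSwinnertonDyer / VerticalContact — crux `PGSelmerBSD` (stmt-BirchSwinnertonDyer-17810):
# the sector split (glue for `route edit --split PGSelmerBSD`)

The potentially-good sector crux of route VerticalContact,
`PGSelmerBSD : ∀ W elliptic, globally minimal, (¬ ∃ q, multiplicative at q) → ∃ p, corank_{ℤ_p} Sel_{p^∞}(W/ℚ) = r_an(W)`,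
follows from THREE items the fleet already staffs on sibling routes — the glue of line `sector-split`
(`Cruxes/PGSelmerBSD/Lines/sector_split.lean`, crux-strategist 2026-08-17; evidence `Split.lean`,
`children.json` on the item), landed here in Theorems form so that the tenure planner can run
`ledger route edit route-BirchSwinnertonDyer-VerticalContact --split PGSelmerBSD --into children.json
--glue-by Summit.BirchSwinnertonDyer.BirchSwinnertonDyer.Theorems.pgSelmerBSD_of_subs`:

* `ToricShedding.UBPotentiallyGood` (stmt-BirchSwinnertonDyer-15878): on the sector, `corank_p ≤ r_an` at every
  big-image good ordinary prime `p ≥ 5`;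
* `VerticalContact.SelmerRankLB` (stmt-BirchSwinnertonDyer-0131; the same term as `SelmerRank.SelmerRankLB`):
  `r_an ≤ corank_p` at every such prime;
* `SelmerRank.SelmerRankCM` (stmt-BirchSwinnertonDyer-18086): `corank_p = r_an` for CM curves at every good
  ordinary `p ≥ 5`.

Composition: `by_cases W.HasCM`; CM — a good ordinary prime `p ≥ 5` exists for every elliptic curve
(`WeierstrassCurve.exists_good_ordinary_prime_holds`, proved) and the CM item applies; non-CM — Serre's open
image theorem in the proved form `exists_goodOrdinary_surjective_of_not_hasCM`
(`Theorems/TangentConeSelmerRankSmallImageReduction`) supplies a big-image good ordinary `p ≥ 5`, where the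
two inequalities give equality. No statement is weakened or restated: the hypotheses are the three route
decls by name and the conclusion is the crux by name.
-/

set_option linter.dupNamespace false

namespace Summit.BirchSwinnertonDyer.BirchSwinnertonDyer.Theorems

open Summit.BirchSwinnertonDyer.BirchSwinnertonDyer.Theses

/-- **Sector split of `PGSelmerBSD`.** The potentially-good sector crux of route VerticalContact follows from
route ToricShedding's `UBPotentiallyGood` (stmt-15878), this route's `SelmerRankLB` (stmt-0131) and route
SelmerRank's `SelmerRankCM` (stmt-18086): case split on `W.HasCM`, primes from
`exists_good_ordinary_prime_holds` (CM) and `exists_goodOrdinary_surjective_of_not_hasCM` (Serre, non-CM),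
then `le_antisymm`. Glue theorem for `route edit --split PGSelmerBSD`. [folklore] -/
theorem pgSelmerBSD_of_subs : Summit.BirchSwinnertonDyer.BirchSwinnertonDyer.Theses.ToricShedding.UBPotentiallyGood → Summit.BirchSwinnertonDyer.BirchSwinnertonDyer.Theses.VerticalContact.SelmerRankLB → Summit.BirchSwinnertonDyer.BirchSwinnertonDyer.Theses.SelmerRank.SelmerRankCM → Summit.BirchSwinnertonDyer.BirchSwinnertonDyer.Theses.VerticalContact.PGSelmerBSD := by
  intro hUB hLB hCM W _ _ hpg
  by_cases hW : W.HasCM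
  · obtain ⟨p, hp, h5, hgood, hord⟩ := WeierstrassCurve.exists_good_ordinary_prime_holds W
    exact ⟨p, hp, hCM W p h5 hgood hord hW⟩
  · obtain ⟨p, hp, h5, hgood, hord, hsurj⟩ := exists_goodOrdinary_surjective_of_not_hasCM W hW
    exact ⟨p, hp, le_antisymm (hUB W hpg p h5 hgood hord hsurj) (hLB W p h5 hgood hord hsurj)⟩

/-- The same split read with route SelmerRank's copy of the lower-bound item (`SelmerRank.SelmerRankLB`,
the same term as `VerticalContact.SelmerRankLB`, stmt-0131). [folklore] -/
theorem pgSelmerBSD_of_subs' (hUB : ToricShedding.UBPotentiallyGood) (hLB : SelmerRank.SelmerRankLB)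
    (hCM : SelmerRank.SelmerRankCM) : VerticalContact.PGSelmerBSD :=
  pgSelmerBSD_of_subs hUB hLB hCM

end Summit.BirchSwinnertonDyer.BirchSwinnertonDyer.Theorems
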